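import Literature.AlgebraicGeometry.Motives.LineSweptTangentCubicSections
import Literature.AlgebraicGeometry.Motives.CubicHyperplaneClassLineSwept
import HarnessLib

/-!
# `H_X^{d-2} ∈ ⟨line-swept⟩` and `CH₂(X) = ⟨line-swept⟩` for smooth cubics of dimension `d ≥ 5`

R. Mboro, *Remarks on the `CH₂` of cubic hypersurfaces* (arXiv:1701.04488), Prop. 1.4: "Let
`X ⊂ ℙⁿ⁺¹_k` … be a smooth cubic hypersurface. Then `H_X^{n-2} ∈ Im(P_*)`. In particular, … for
`n ≥ 5`, `P_* : CH₁(F(X)) → CH₂(X)` is surjective." `Motives/CubicHyperplaneClassLineSwept` proves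
the tree's rendering (`Im(P_*)` by line-swept classes) for every integral cubic of dimension
`≥ 7` through a PLANE of `X`. This file reaches Mboro's range `d ≥ 5` for SMOOTH cubics with Mboro's
own section: a `3`-plane `M` TANGENT TO `X` ALONG A LINE `l₀ ⊆ X` — here any line (the printed
proof takes a line of second type and `n ≥ 4`; with an arbitrary line the tangent space along
`l₀` has codimension `≤ 3`, so a tangent `3`-plane through `l₀` not contained in `X` exists as soon
as `d ≥ 5`, by the Jacobian criterion in the form "a cubic vanishing on a subspace of more than half
the dimension has a singular zero on it",
`Literature.RingTheory.MvPolynomial.exists_ne_zero_pderiv_eval_eq_zero_of_isotropic`). The cubic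
surface `S = X ∩ M` is singular along `l₀`, and every component of the cycle `[X ∩ M] = V₊(F) · [M]`
is a line-swept surface (`ProjFamily.isLineSweptPoint_of_mem_tangentCubicSection`,
`Motives/LineSweptTangentCubicSections`: the residual lines of the planes through `l₀`).

* `Hypersurface.hyperplaneSectionOnIter_two_mem_closure_lineSweptClasses_of_smooth` —
  **`H_X^{d-2} ∩ [X] ∈ ⟨line-swept⟩` for a smooth cubic hypersurface of dimension `d ≥ 5`**
  (`2 ≠ 0`);
* `Hypersurface.closure_lineSweptClasses_eq_top_of_smooth` — **`CH₂(X) = ⟨line-swept surfaces⟩`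
  for smooth cubics of dimension `d ≥ 5`** (with `ProjFamily.mem_zmultiples_sup_closure_lineSweptClasses`,
  Thms. 1.2–1.3): Prop. 1.4's "for `n ≥ 5`, `P_*` is surjective" in the tree's rendering;
* `Hypersurface.chowTwo_cubic_closure_lineSweptClasses_eq_top_of_five_le` — the same in the
  binders of the named fact `Mboro2018_chowTwo_cubic` (`n ≥ 5`).

Everything is proved; no named facts.

## References

* [Mboro2018] R. Mboro, Remarks on the CH₂ of cubic hypersurfaces, Geom. Dedicata 200 (2019) =
  arXiv:1701.04488: Prop. 1.4 and its proof (p. 8).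
* [Fulton1998] W. Fulton, Intersection Theory, 2nd ed. (1998), Def. 2.3, Example 2.5.1.
* [Hartshorne1977] R. Hartshorne, Algebraic Geometry (1977), I Thm. 5.1, I Ex. 5.8 (Jacobian
  criterion).
-/

noncomputable section

open CategoryTheory AlgebraicGeometry Order MvPolynomial
open Literature.AlgebraicGeometry.Motives.Segre

universe u

namespace Literature.AlgebraicGeometry.Motives

attribute [local instance] MvPolynomial.gradedAlgebra

namespace Hypersurface

open ProjSpace ProjectiveSpace ProjectiveSpaceCells Literature.RingTheory.MvPolynomial ProjFamily

/-! ### `H_X^{d-2} ∈ ⟨line-swept⟩` for smooth cubics, `d ≥ 5` -/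

section Integral

variable {k : Type u} [Field k] [IsAlgClosed k] {d : ℕ} (X : SchemeOver k) [IsIntegral X.left]
  [LocallyOfFiniteType X.hom] (i : X ⟶ projectiveSpace (d + 1) k) [IsClosedImmersion i.left]
  {F : MvPolynomial (Fin (d + 1 + 1)) k}

/-- **`c₁(𝒪_X(1))^{d-2} ∩ [X]` is an integral combination of line-swept surface classes on a smooth
cubic hypersurface of dimension `d ≥ 5`** (Mboro, Prop. 1.4: `H_X^{n-2} ∈ Im(P_*)`). Let
`X = V₊(F) ⊆ ℙᵈ⁺¹_k` (`k` algebraically closed, `2 ≠ 0`, `F` a prime cubic, `d ≥ 5`) have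
non-vanishing gradient at every non-zero zero of `F`. Take a line `l₀ = ℙ(span(a, b)) ⊆ X` and the
subspace `Λ̂` of the directions tangent to `X` along `l₀` (`F'_a = F'_b = F'_{a+b} = 0`, codimension
`≤ 3`): `F ≢ 0` on `Λ̂` (else `Λ̂` would carry a singular zero, `2 dim Λ̂ > d + 2`), so there is a
`3`-plane `M = ℙ(span(a, b, u, v)) ⊄ X`, `u, v ∈ Λ̂`, tangent to `X` along `l₀`; every component of
`[X ∩ M] = V₊(F) · [M]` is line-swept (`isLineSweptPoint_of_mem_tangentCubicSection`).
[cite: Mboro2018, Prop. 1.4 and its proof (arXiv:1701.04488, p. 8)] [cite: Hartshorne1977, I Thm. 5.1 and Ex. 5.8] -/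
theorem hyperplaneSectionOnIter_two_mem_closure_lineSweptClasses_of_smooth (hd : 5 ≤ d) (h2 : (2 : k) ≠ 0)
    (hF : F ∈ grading (Fin (d + 1 + 1)) k 3) (hprime : Prime F)
    (hrange : Set.range i.left.base =
      ProjectiveSpectrum.zeroLocus (MvPolynomial.homogeneousSubmodule (Fin (d + 1 + 1)) k) {F})
    (hJ : ∀ z : Fin (d + 1 + 1) → k, z ≠ 0 → eval z F = 0 → ∃ j, eval z (pderiv j F) ≠ 0)
    {c : ℕ} (hdim : 2 + c = d) {ℓ₀ : MvPolynomial (Fin (d + 1 + 1)) k}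
    (hℓ₀ : ℓ₀ ∈ grading (Fin (d + 1 + 1)) k 1) (hℓ₀0 : ℓ₀ ≠ 0)
    (hX₀ : (formDivisor ℓ₀ hℓ₀ hℓ₀0).Avoids (i.left.base (genericPoint ↥X.left))) :
    hyperplaneSectionOnIter i hℓ₀ hℓ₀0 hX₀ 2 c
        (ChowGroup.mk X.left (2 + c) ⟨primeCycle (genericPoint ↥X.left), primeCycle_mem_cyclesOfDim
          (by rw [Hypersurface.height_genericPoint i hF hprime hrange]; exact_mod_cast hdim.symm)⟩) ∈
      AddSubgroup.closure (lineSweptClasses i) := by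
  classical
  haveI : CompactSpace ↥X.left := i.left.isClosedEmbedding.compactSpace
  have hF3 : F.IsHomogeneous 3 := (mem_homogeneousSubmodule 3 F).1 hF
  have hF0 : F ≠ 0 := hprime.ne_zero
  -- (1) a line `l₀ = ℙ(span(a, b)) ⊆ X`
  obtain ⟨W, hW2, hWiso⟩ := exists_submodule_finrank_two_eval_cubic_eq_zero (N := d + 1) (by omega) hF3
  obtain ⟨ab, hab, habspan⟩ := exists_frame_of_finrank_eq hW2
  set a := ab 0 with ha
  set b := ab 1 with hb
  have habmem : ∀ s t : k, s • a + t • b ∈ W := by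
    intro s t
    rw [← habspan]
    exact Submodule.add_mem _ (Submodule.smul_mem _ _ (Submodule.subset_span ⟨0, rfl⟩))
      (Submodule.smul_mem _ _ (Submodule.subset_span ⟨1, rfl⟩))
  have hl₀ : ∀ s t : k, eval (s • a + t • b) F = 0 := fun s t => hWiso _ (habmem s t)
  -- (2) the directions `Λ̂` tangent to `X` along `l₀`: `F'_a = F'_b = F'_{a+b} = 0`
  obtain ⟨φa, hφa⟩ := exists_linearMap_forall_eval_eq (isHomogeneous_lin (fun j => eval a (pderiv j F)))
  obtain ⟨φb, hφb⟩ := exists_linearMap_forall_eval_eq (isHomogeneous_lin (fun j => eval b (pderiv j F)))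
  obtain ⟨φab, hφab⟩ := exists_linearMap_forall_eval_eq (isHomogeneous_lin (fun j => eval (a + b) (pderiv j F)))
  have hlinval : ∀ y z : Fin (d + 1 + 1) → k, eval z (lin fun j => eval y (pderiv j F)) = dirD F y z := by
    intro y z
    rw [eval_lin]
    unfold dirD
    rw [dotProduct]
    refine Finset.sum_congr rfl fun j _ => mul_comm _ _
  let Φ : (Fin (d + 1 + 1) → k) →ₗ[k] (Fin 3 → k) := LinearMap.pi (![φa, φb, φab])
  set Λ : Submodule k (Fin (d + 1 + 1) → k) := LinearMap.ker Φ with hΛ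
  have hΛmem : ∀ z, z ∈ Λ ↔ dirD F a z = 0 ∧ dirD F b z = 0 ∧ dirD F (a + b) z = 0 := by
    intro z
    rw [hΛ, LinearMap.mem_ker]
    constructor
    · intro h
      have h0 := congr_fun h 0
      have h1 := congr_fun h 1
      have h2' := congr_fun h 2
      simp only [Φ, LinearMap.pi_apply, Pi.zero_apply] at h0 h1 h2'
      refine ⟨?_, ?_, ?_⟩
      · rw [← hlinval, hφa]; exact h0
      · rw [← hlinval, hφb]; exact h1
      · rw [← hlinval, hφab]; exact h2'
    · rintro ⟨h0, h1, h2'⟩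
      funext t
      fin_cases t
      · change φa z = 0; rw [← hφa, hlinval]; exact h0
      · change φb z = 0; rw [← hφb, hlinval]; exact h1
      · change φab z = 0; rw [← hφab, hlinval]; exact h2'
  -- `dim Λ̂ ≥ d - 1`
  have hΛdim : d + 1 + 1 ≤ Module.finrank k Λ + 3 := by
    have h := LinearMap.finrank_range_add_finrank_ker Φ
    have hr : Module.finrank k (LinearMap.range Φ) ≤ 3 := by
      calc Module.finrank k (LinearMap.range Φ) ≤ Module.finrank k (Fin 3 → k) := Submodule.finrank_le _
        _ = 3 := by simp
    rw [Module.finrank_fin_fun] at h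
    rw [hΛ]
    omega
  -- tangency along `l₀`: the polar form of any `z ∈ Λ̂` vanishes on `span(a, b)`
  have hpol : ∀ z ∈ Λ, ∀ s t : k, eval (s • a + t • b) (polarForm F z) = 0 := by
    intro z hz s t
    obtain ⟨h0, h1, h2'⟩ := (hΛmem z).1 hz
    have hq : (polarForm F z).IsHomogeneous 2 := isHomogeneous_polarForm hF3 z
    have hab' : qpolar (polarForm F z) a b = 0 := by
      have h := eval_add_eq_qpolar hq h2 a b
      rw [eval_polarForm, eval_polarForm, eval_polarForm, h2', h0, h1, zero_add, add_zero] at h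
      exact h.symm
    rw [eval_add_smul_smul_eq hq h2, eval_polarForm, eval_polarForm, h0, h1, hab', mul_zero, mul_zero,
      mul_zero, add_zero, add_zero]
  -- `a, b ∈ Λ̂`
  have hdir0 : ∀ y ∈ W, ∀ z ∈ W, dirD F y z = 0 := by
    intro y hy z hz
    exact dirD_eq_zero_of_forall_eval_add_smul fun r => hWiso _ (Submodule.add_mem _ hy (Submodule.smul_mem _ _ hz))
  have haW : a ∈ W := by simpa using habmem 1 0
  have hbW : b ∈ W := by simpa using habmem 0 1
  have habW : a + b ∈ W := by simpa using habmem 1 1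
  have haΛ : a ∈ Λ := (hΛmem a).2 ⟨hdir0 a haW a haW, hdir0 b hbW a haW, hdir0 _ habW a haW⟩
  have hbΛ : b ∈ Λ := (hΛmem b).2 ⟨hdir0 a haW b hbW, hdir0 b hbW b hbW, hdir0 _ habW b hbW⟩
  -- (3) `F ≢ 0` on `Λ̂` (smoothness), a direction `v ∈ Λ̂` with `F(v) ≠ 0`
  obtain ⟨v, hvΛ, hFv⟩ : ∃ v ∈ Λ, eval v F ≠ 0 := by
    by_contra hall
    push Not at hall
    obtain ⟨z, hzΛ, hz0, hzJ⟩ := exists_ne_zero_pderiv_eval_eq_zero_of_isotropic hF3 (W := Λ) rfl hall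
      (by omega)
    obtain ⟨j, hj⟩ := hJ z hz0 (hall z hzΛ)
    exact hj (hzJ j)
  have hvW : v ∉ W := fun h => hFv (hWiso v h)
  have hvec : (![a, b] : Fin 2 → Fin (d + 1 + 1) → k) = ab := by funext j; fin_cases j <;> rfl
  have hvab : v ∉ Submodule.span k (Set.range ![a, b]) := by
    rw [hvec, habspan]; exact hvW
  -- (4) `u ∈ Λ̂ ∖ span(a, b, v)`
  obtain ⟨u, huΛ, huabv⟩ : ∃ u ∈ Λ, u ∉ Submodule.span k (Set.range ![a, b, v]) := by
    by_contra hall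
    push Not at hall
    have hle : Λ ≤ Submodule.span k (Set.range ![a, b, v]) := fun z hz => hall z hz
    have h3 : Module.finrank k (Submodule.span k (Set.range ![a, b, v])) ≤ 3 :=
      (finrank_range_le_card _).trans (by simp)
    have := Submodule.finrank_mono hle
    omega
  -- (5) the frame `n = (a, b, u, v)` of `M̂`
  have habli : LinearIndependent k ![a, b] := by rw [hvec]; exact hab
  have habvli : LinearIndependent k ![a, b, v] := by
    have h : (![a, b, v] : Fin 3 → Fin (d + 1 + 1) → k) = Fin.snoc ![a, b] v := by
      funext j; fin_cases j <;> rfl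
    rw [h]; exact linearIndependent_finSnoc.2 ⟨habli, hvab⟩
  have habvuli : LinearIndependent k ![a, b, v, u] := by
    rw [vecCons_four_eq_snoc_snoc]
    refine linearIndependent_finSnoc.2 ⟨?_, ?_⟩
    · have h : (Fin.snoc ![a, b] v : Fin 3 → Fin (d + 1 + 1) → k) = ![a, b, v] := by
        funext j; fin_cases j <;> rfl
      rw [h]; exact habvli
    · have h : Set.range (Fin.snoc ![a, b] v : Fin 3 → Fin (d + 1 + 1) → k) = Set.range ![a, b, v] := by
        congr 1; funext j; fin_cases j <;> rfl
      rw [h]; exact huabv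
  let n : Fin 4 → Fin (d + 1 + 1) → k := ![a, b, u, v]
  have hn : LinearIndependent k n := by
    have h : n = ![a, b, v, u] ∘ Equiv.swap (2 : Fin 4) 3 := by
      funext j; fin_cases j <;> rfl
    rw [h]; exact habvuli.comp _ (Equiv.injective _)
  have hvn : v ∈ Submodule.span k (Set.range n) := Submodule.subset_span ⟨3, rfl⟩
  -- (6) the equations `L` of `M = ℙ(span n)`
  obtain ⟨c', L, hc', hLli, hLhom, hLvan, hLideal⟩ := exists_linearForms_forall_mem_ideal_span_vanishing hn
  obtain rfl : c = c' := by omega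
  have hL : ∀ j, L j ∈ grading (Fin (d + 1 + 1)) k 1 := fun j => (mem_homogeneousSubmodule 1 _).2 (hLhom j)
  have hLM : ∀ P : Fin (d + 1 + 1) → k, (∀ j, eval P (L j) = 0) ↔ P ∈ Submodule.span k (Set.range n) := by
    intro P
    refine ⟨fun hP => ?_, fun hP j => hLvan j P hP⟩
    by_contra hPm
    obtain ⟨lam, hlamhom, hlamvan, hlamP⟩ := exists_linearForm_vanishing_eval_ne_zero hn hPm
    exact hlamP (eval_eq_zero_of_mem_idealSpan_of_forall hP (hLideal lam hlamvan))
  have hFL : F ∉ Ideal.span (Set.range L) := fun h =>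
    hFv (eval_eq_zero_of_mem_idealSpan_of_forall (fun j => hLvan j v hvn) h)
  -- (7) the generic point `w` of `M`, the hyperplanes `V₊(L_j) ⊅ X`
  obtain ⟨w, hw, hwh, -⟩ := exists_point_of_linearIndependent L hLli hLhom (by omega)
  have hFw : F ∉ ProjectiveSpectrum.asHomogeneousIdeal
      (𝒜 := MvPolynomial.homogeneousSubmodule (Fin (d + 1 + 1)) k) w := by
    intro h; apply hFL; rw [← hw]; exact h
  have hav : ∀ j, (formDivisor (L j) (hL j) (hLli.ne_zero j)).Avoids (i.left.base (genericPoint ↥X.left)) := by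
    intro j
    refine formDivisor_avoids_base_genericPoint i hF hprime hrange (hL j) (hLli.ne_zero j) fun h => hFL ?_
    exact Ideal.span_mono (Set.singleton_subset_iff.2 (Set.mem_range_self j)) h
  -- (8) the cycle `i_* [X ∩ M] = V₊(F) · [M]`
  set Z : AlgebraicCycle (projectiveSpace (d + 1) k).left ℤ :=
    (formDivisor F hF hF0).primeInter (X := projectiveSpace (d + 1) k) w with hZ
  have hid : AlgebraicCycle.map i.left height height
      (CartierDivisor.iterInter c (fun j => (formDivisor (L j) (hL j) (hLli.ne_zero j)).pullbackAvoiding i.left (hav j))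
        (primeCycle (genericPoint ↥X.left))) = Z :=
    map_iterInter_primeCycle_eq_primeInter i hF hprime hrange c L hL hLli (by omega) hav w hw hFw
  have hw3 : height w = (2 : ℕ) + 1 := by
    rw [hwh, show d + 1 - c = 3 by omega]; rfl
  have hZdim : Z ∈ cyclesOfDim (projectiveSpace (d + 1) k).left 2 :=
    (formDivisor F hF hF0).primeInter_mem_cyclesOfDim (X := projectiveSpace (d + 1) k) hw3
  have hZsupp : ∀ x, Z x ≠ 0 → height x = 2 ∧ F ∈ ProjectiveSpectrum.asHomogeneousIdeal
      (𝒜 := MvPolynomial.homogeneousSubmodule (Fin (d + 1 + 1)) k) x ∧ ∀ j, L j ∈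
        ProjectiveSpectrum.asHomogeneousIdeal (𝒜 := MvPolynomial.homogeneousSubmodule (Fin (d + 1 + 1)) k) x := by
    intro x hx
    refine ⟨hZdim x hx, ?_, fun j => ?_⟩
    · have h := (formDivisor F hF hF0).not_avoids_of_primeInter_ne_zero (X := projectiveSpace (d + 1) k) hx
      by_contra hFx
      exact h ((formDivisor_avoids_iff hF hF0 three_pos).2 hFx)
    · have hwx : w ⤳ x := (formDivisor F hF hF0).specializes_of_primeInter_ne_zero
        (X := projectiveSpace (d + 1) k) hx
      have hle := specializes_iff_le.1 hwx
      have hLw : L j ∈ (ProjectiveSpectrum.asHomogeneousIdeal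
          (𝒜 := MvPolynomial.homogeneousSubmodule (Fin (d + 1 + 1)) k) w).toIdeal := by
        rw [hw]; exact Ideal.subset_span ⟨j, rfl⟩
      exact hle hLw
  have hZrange : Function.support Z ⊆ Set.range i.left.base := by
    intro x hx
    obtain ⟨-, hFx, -⟩ := hZsupp x hx
    refine (Set.ext_iff.mp hrange x).mpr ?_
    intro G hG
    rw [Set.mem_singleton_iff.mp hG]
    exact hFx
  -- (9) restrict to `X`
  set ZX : AlgebraicCycle X.left ℤ := cycleRestrictClosed i.left Z with hZX
  have hZX2 : ZX ∈ cyclesOfDim X.left 2 := cycleRestrictClosed_mem_cyclesOfDim i.left hZdim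
  have hiter : CartierDivisor.iterInter c
      (fun j => (formDivisor (L j) (hL j) (hLli.ne_zero j)).pullbackAvoiding i.left (hav j))
      (primeCycle (genericPoint ↥X.left)) = ZX := by
    refine algebraicCycleMap_injective_of_isClosedImmersion i.left ?_
    rw [hid, hZX, map_cycleRestrictClosed i.left Z hZrange]
  have hdimX : primeCycle (genericPoint ↥X.left) ∈ cyclesOfDim X.left (2 + c) :=
    primeCycle_mem_cyclesOfDim (by rw [Hypersurface.height_genericPoint i hF hprime hrange]; exact_mod_cast hdim.symm)
  rw [← mk_iterInter_primeCycle_eq_hyperplaneSectionOnIter i hF hprime hrange hdim L hL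
    (fun j => hLli.ne_zero j) hav hℓ₀ hℓ₀0 hX₀]
  have hsplit : (⟨CartierDivisor.iterInter c
      (fun j => (formDivisor (L j) (hL j) (hLli.ne_zero j)).pullbackAvoiding i.left (hav j))
      (primeCycle (genericPoint ↥X.left)), CartierDivisor.iterInter_mem_cyclesOfDim c _ hdimX⟩ :
        ↥(cyclesOfDim X.left 2)) = ⟨ZX, hZX2⟩ := Subtype.ext hiter
  rw [hsplit]
  -- (10) every component of `Z_X` is a line-swept surface
  refine ChowGroup.mk_mem_of_forall_ofPoint_mem ⟨ZX, hZX2⟩ fun η hη => AddSubgroup.subset_closure ⟨η, ?_, rfl⟩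
  have hη : Z (i.left.base η) ≠ 0 := by
    change ZX η ≠ 0 at hη
    rwa [hZX, cycleRestrictClosed_apply] at hη
  obtain ⟨hηi2, -, hLη⟩ := hZsupp _ hη
  have hη2 : height η = 2 := by rw [← height_base_eq_of_isClosedImmersion' i.left]; exact hηi2
  exact isLineSweptPoint_of_mem_tangentCubicSection X i h2 (by omega) hF3 hrange L hLhom hLli n hn hLM hl₀
    (hpol u huΛ) (hpol v hvΛ) ⟨v, hvn, hFv⟩ hη2 hLη

/-- **`CH₂(X) = ⟨line-swept surfaces⟩` for a smooth cubic hypersurface of dimension `d ≥ 5`**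
(Mboro, Prop. 1.4: "for `n ≥ 5`, `P_* : CH₁(F(X)) → CH₂(X)` is surjective", `Im(P_*)` rendered by
`lineSweptClasses`): `CH₂(X) = ℤ h + ⟨line-swept⟩` for every integral cubic of dimension `≥ 5`
(`ProjFamily.mem_zmultiples_sup_closure_lineSweptClasses`, Thms. 1.2–1.3) and `h ∈ ⟨line-swept⟩`
(`hyperplaneSectionOnIter_two_mem_closure_lineSweptClasses_of_smooth`).
[cite: Mboro2018, Prop. 1.4, Thm. 1.2 and Thm. 1.3 (arXiv:1701.04488, pp. 6–8)] -/
theorem closure_lineSweptClasses_eq_top_of_smooth (hd : 5 ≤ d) (h2 : (2 : k) ≠ 0)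
    (hF : F ∈ grading (Fin (d + 1 + 1)) k 3) (hprime : Prime F)
    (hrange : Set.range i.left.base =
      ProjectiveSpectrum.zeroLocus (MvPolynomial.homogeneousSubmodule (Fin (d + 1 + 1)) k) {F})
    (hJ : ∀ z : Fin (d + 1 + 1) → k, z ≠ 0 → eval z F = 0 → ∃ j, eval z (pderiv j F) ≠ 0) :
    AddSubgroup.closure (lineSweptClasses i) = ⊤ := by
  have hF3 : F.IsHomogeneous 3 := (mem_homogeneousSubmodule 3 F).1 hF
  -- a hyperplane `V₊(ℓ₀) ⊅ X`
  obtain ⟨ℓv, hlin, hhom, hFℓ⟩ := exists_linearForms_not_mem_idealSpan (N := d + 1) three_pos hF3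
    hprime.ne_zero (c := 1) (by omega)
  have hℓ₀ : ℓv 0 ∈ grading (Fin (d + 1 + 1)) k 1 := (mem_homogeneousSubmodule 1 _).2 (hhom 0)
  have hℓ₀0 : ℓv 0 ≠ 0 := hlin.ne_zero 0
  have hX₀ : (formDivisor (ℓv 0) hℓ₀ hℓ₀0).Avoids (i.left.base (genericPoint ↥X.left)) := by
    refine formDivisor_avoids_base_genericPoint i hF hprime hrange hℓ₀ hℓ₀0 fun h => hFℓ ?_
    exact Ideal.span_mono (Set.singleton_subset_iff.2 (Set.mem_range_self 0)) h
  have hdim : 2 + (d - 2) = d := by omega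
  rw [eq_top_iff]
  intro γ _
  have hmem := ProjFamily.mem_zmultiples_sup_closure_lineSweptClasses X i hd hF hprime hrange hdim
    hℓ₀ hℓ₀0 hX₀ γ
  have hh := hyperplaneSectionOnIter_two_mem_closure_lineSweptClasses_of_smooth X i hd h2 hF hprime hrange hJ
    hdim hℓ₀ hℓ₀0 hX₀
  exact (sup_le (AddSubgroup.zmultiples_le_of_mem hh) le_rfl) hmem

end Integral

/-! ### In the binders of the named fact -/

section Fact

/-- **`CH₂` of a smooth cubic hypersurface of dimension `n ≥ 5` over an algebraically closed field
of characteristic zero is generated by the classes of its line-swept surfaces** (Mboro, Prop. 1.4: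
`P_*` is surjective for `n ≥ 5`), in the binders of `Mboro2018_chowTwo_cubic`: `X` is integral
(`IsSmoothProjective.isIntegral_holds`), `F` is prime, and the gradient of `F` vanishes at no
non-zero zero (the Jacobian criterion `IsSmoothProjective.exists_eval_pderiv_ne_zero`).
[cite: Mboro2018, Prop. 1.4 (arXiv:1701.04488, p. 8)] [cite: Hartshorne1977, I Thm. 5.1 and Ex. 5.8] -/
theorem chowTwo_cubic_closure_lineSweptClasses_eq_top_of_five_le {k : Type u} [Field k] [IsAlgClosed k]
    [CharZero k] (n : ℕ) {X : SchemeOver k} (F : MvPolynomial (Fin (n + 1 + 1)) k)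
    (i : X ⟶ projectiveSpace (n + 1) k) (hX : IsSmoothProjective n X) (hF : F.IsHomogeneous 3)
    (hirr : Irreducible F) [hi : IsClosedImmersion i.left]
    (hV : Set.range i.left.base =
      ProjectiveSpectrum.zeroLocus (MvPolynomial.homogeneousSubmodule (Fin (n + 1 + 1)) k) {F})
    (hn : 5 ≤ n) :
    AddSubgroup.closure (lineSweptClasses i) = ⊤ := by
  haveI : IsIntegral X.left := IsSmoothProjective.isIntegral_holds hX
  haveI : IsProper (projectiveSpace (n + 1) k).hom := isProper_projectiveSpace (n + 1) k
  haveI : LocallyOfFiniteType X.hom := by rw [← Over.w i]; infer_instance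
  have hprime : Prime F := UniqueFactorizationMonoid.irreducible_iff_prime.1 hirr
  have hFg : F ∈ grading (Fin (n + 1 + 1)) k 3 := (mem_homogeneousSubmodule 3 F).2 hF
  have hJ : ∀ z : Fin (n + 1 + 1) → k, z ≠ 0 → eval z F = 0 → ∃ j, eval z (pderiv j F) ≠ 0 :=
    fun z hz hFz => IsSmoothProjective.exists_eval_pderiv_ne_zero hX hF hirr i hV hz hFz
  exact closure_lineSweptClasses_eq_top_of_smooth X i hn two_ne_zero hFg hprime hV hJ

end Fact

end Hypersurface

end Literature.AlgebraicGeometry.Motives
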